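import Mathlib.RepresentationTheory.Invariants
import Mathlib.GroupTheory.Index
import Mathlib.Data.ZMod.Basic
import Literature.RepresentationTheory.FiniteGroups.StableLatticeReductionInvariantInt
import HarnessLib

/-!
# Additive invariants of finite `p`-torsion `ℤ[G]`-modules, II: recognising the permutation module
# `ℤ[G/D]/p`, and formal prime-to-`p` descent along an inclusion ∕ trace pair

Topic `RepresentationTheory/FiniteGroups`; namespace `Literature.RepresentationTheory.FiniteGroups`
(sub-namespace `StableLatticeReduction.Int`, continued).  THEOREMS ONLY (no definition, no named
fact, no `sorry`, no instance).  Companion of `AdditiveInvariantFiniteModuleHerbrand`; the binder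
pair `(ψ, hψ)` of `StableLatticeReductionInvariantInt` verbatim (additivity on short exact
sequences with FINITE middle term KILLED BY `p`).

Source (Milne, *Arithmetic Duality Theorems*, I §5, proof of Thm. 5.1, p. 70): after the reduction
to `Ḡ = Gal(L/K)` cyclic of order prime to `p`, "`Hʳ(G_S, M) = Hʳ(Gal(K_S/L), M)^Ḡ`" (prime-to-`p`
descent) and the class `[H²(Gal(K_S/L), E_S)(p)]` is the permutation class of the places of `L`
above `S` minus `[𝔽_p]` (the Brauer-group term of Tate's computation).  In the lane's right-action
model `Hⁿ(Γ, Maps(Δ, A))` (B2 `coindOpen`) both become ALGEBRA: descent is the formal statement §4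
about any pair `i, π` with `π ∘ i = #D`, `i ∘ π = Σ_d d`, and the permutation class is recognised
by §3 from an orbit that spans and a count.

## What is formalised (`p` a prime)

* §3 `natCard_monoidAlgebra_quotient_smul_top` — `#(ℤ[X]/p) = p ^ #X`;
  `forall_apply_eq_self_of_card_le_card_invariants` — `#V ≤ #V^D` forces a trivial action;
  **`additive_eq_permutation_quotient_of_generator`** — a finite `𝔽_p[G]`-module spanned by the
  `G`-orbit of a vector fixed by `D ≤ G`, of order `p ^ [G : D]`, has `ψ V = ψ (ℤ[G/D]/p)`
  (`Representation.ofMulAction ℤ G (G ⧸ D)`, the object of `PermutationLatticeReduction`).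
* §4 **`exists_torsionBy_linearEquiv_of_trace`** (no `ψ`) — FORMAL DESCENT: for `ℤ`-linear
  `i : X → Y`, `π : Y → X` and an action `τ` of a finite group `D` on `Y` with `π ∘ i = #D`,
  `i ∘ π = Σ_d τ d`, `τ d ∘ i = i` and `p ∤ #D`: `X[p] ≅ Y[p] ∩ Y^D` along `i`
  (+ `natCard_torsionBy_eq_of_trace`); the lane instantiates it with `X = Hⁿ(Γ, Maps(Δ/D, A))`,
  `Y = Hⁿ(Γ, Maps(Δ, A))`, `i, π = Hⁿ(incl), Hⁿ(trace)`.
* §3′–§4′ primed versions for NON-canonical `Module ℤ` instances (the `isModule` field of the lane's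
  `ModuleCat` cohomology carriers) with `ℕ`-scalar torsion hypotheses and presentation-agnostic
  submodules: `additive_eq_permutation_quotient_of_generator'`, `exists_linearEquiv_of_trace'`,
  `natCard_eq_of_trace'`.

Written for lane «TATE-EPC-TC» of cell `bsd-eis` (road memo = evidence #54 on
stmt-BirchSwinnertonDyer-19032), brick B8, pieces «B8-ψalg».

## References
* J. S. Milne, *Arithmetic Duality Theorems*, 2nd ed. (2006), I §5, proof of Thm. 5.1 (p. 70);
  I Lemma 2.12. [MilneADT2006]
* J.-P. Serre, *Linear Representations of Finite Groups*, GTM 42 (1977), §15.1–15.2 (Thm. 32).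
  [SerreLinearRepresentations1977]
-/

universe u

namespace Literature.RepresentationTheory.FiniteGroups

namespace StableLatticeReduction.Int

open Function LinearMap Submodule StableLatticeReduction
open scoped Pointwise

variable {A : Type*} [AddCommGroup A] {p : ℕ}

/-! ### §3. Recognising a permutation module `ℤ[G/D]/p` -/

/-- **`#(ℤ[X]/p) = p ^ #X`** for a finite set `X`: reduction of coefficients
`ℤ[X]/p ≅ (X → ℤ/p)` (on Mathlib's `MonoidAlgebra ℤ X`, the carrier of `Representation.ofMulAction`).
[cite: SerreLinearRepresentations1977, §15.1–15.2] -/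
theorem natCard_monoidAlgebra_quotient_smul_top [hp : Fact p.Prime] (X : Type u) [Finite X] :
    Nat.card (MonoidAlgebra ℤ X ⧸ ((p : ℤ) • ⊤ : Submodule ℤ (MonoidAlgebra ℤ X))) =
      p ^ Nat.card X := by
  classical
  -- reduction of coefficients
  let χ₀ : MonoidAlgebra ℤ X →+ (X → ZMod p) :=
    { toFun := fun f x => ((f.coeff x : ℤ) : ZMod p)
      map_zero' := funext fun x => by
        rw [MonoidAlgebra.coeff_zero, Finsupp.zero_apply, Int.cast_zero, Pi.zero_apply]
      map_add' := fun f g => funext fun x => by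
        rw [MonoidAlgebra.coeff_add, Finsupp.add_apply, Int.cast_add, Pi.add_apply] }
  let χ : MonoidAlgebra ℤ X →ₗ[ℤ] (X → ZMod p) := χ₀.toIntLinearMap
  have hχ : ∀ f x, χ f x = ((f.coeff x : ℤ) : ZMod p) := fun _ _ => rfl
  have hsurj : Surjective χ := fun h => by
    refine ⟨MonoidAlgebra.ofCoeff (Finsupp.equivFunOnFinite.symm fun x => (((h x).val : ℕ) : ℤ)),
      funext fun x => ?_⟩
    rw [hχ, MonoidAlgebra.coeff_ofCoeff, Finsupp.coe_equivFunOnFinite_symm, Int.cast_natCast,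
      ZMod.natCast_zmod_val]
  have hker : LinearMap.ker χ = ((p : ℤ) • ⊤ : Submodule ℤ (MonoidAlgebra ℤ X)) := by
    ext f
    rw [LinearMap.mem_ker, mem_smul_pointwise_iff_exists]
    constructor
    · intro hf
      have hdvd : ∀ x, (p : ℤ) ∣ f.coeff x := fun x =>
        (ZMod.intCast_zmod_eq_zero_iff_dvd (f.coeff x) p).1 (by rw [← hχ, hf, Pi.zero_apply])
      refine ⟨MonoidAlgebra.ofCoeff (Finsupp.mapRange (fun n : ℤ => n / p) (by rw [Int.zero_ediv])
        f.coeff), mem_top, MonoidAlgebra.ext (Finsupp.ext fun x => ?_)⟩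
      rw [MonoidAlgebra.coeff_smul, MonoidAlgebra.coeff_ofCoeff, Finsupp.smul_apply,
        Finsupp.mapRange_apply, smul_eq_mul, Int.mul_ediv_cancel' (hdvd x)]
    · rintro ⟨g, -, rfl⟩
      funext x
      rw [hχ, MonoidAlgebra.coeff_smul, Finsupp.smul_apply, smul_eq_mul, Int.cast_mul,
        Int.cast_natCast, ZMod.natCast_self, zero_mul, Pi.zero_apply]
  have e := (Submodule.quotEquivOfEq _ _ hker.symm).trans (LinearMap.quotKerEquivOfSurjective χ hsurj)
  rw [Nat.card_congr e.toEquiv, Nat.card_fun, Nat.card_zmod]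

/-- A count forces a trivial action: if `#V ≤ #V^D` (`V` finite) then `D` acts trivially on `V`.
(Lane use: `dim (H²(J_v)[p])^{Δ_v} = [Δ : Δ_v] = dim H²(J_v)[p]`, both by Shapiro.)
[cite: MilneADT2006, I §5, proof of Thm. 5.1] -/
theorem forall_apply_eq_self_of_card_le_card_invariants {D : Type*} [Group D] {V : Type u}
    [AddCommGroup V] [Finite V] (τ : Representation ℤ D V)
    (h : Nat.card V ≤ Nat.card τ.invariants) (d : D) (v : V) : τ d v = v := by
  have htop : τ.invariants.toAddSubgroup = ⊤ :=
    AddSubgroup.eq_top_of_card_eq _ (le_antisymm (AddSubgroup.card_le_card_addGroup _) h)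
  have hv : v ∈ τ.invariants := by
    rw [← Submodule.mem_toAddSubgroup, htop]; exact AddSubgroup.mem_top v
  exact (Representation.mem_invariants τ v).1 hv d

section Permutation

variable {G : Type} [Group G]
variable (ψ : ∀ ⦃X : Type⦄ [AddCommGroup X] [Module ℤ X], Representation ℤ G X → A)
  (hψ : ∀ ⦃X Y Z : Type⦄ [AddCommGroup X] [Module ℤ X] [AddCommGroup Y] [Module ℤ Y]
    [AddCommGroup Z] [Module ℤ Z] (ρX : Representation ℤ G X) (ρY : Representation ℤ G Y)
    (ρZ : Representation ℤ G Z) (f : X →ₗ[ℤ] Y) (g : Y →ₗ[ℤ] Z),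
    (∀ s x, f (ρX s x) = ρY s (f x)) → (∀ s y, g (ρY s y) = ρZ s (g y)) →
    Injective f → Surjective g → LinearMap.range f = LinearMap.ker g → Finite Y →
    (∀ y : Y, (p : ℤ) • y = 0) → ψ ρY = ψ ρX + ψ ρZ)
include hψ

/-- **Recognition of the permutation module `ℤ[G/D]/p`.**  Let `V` be a finite `ℤ[G]`-module killed
by `p`, spanned by the `G`-orbit of a vector `v₁` fixed by the subgroup `D`, with
`#V = p ^ [G : D]`.  Then the orbit map `[g] ↦ g v₁` induces a `G`-isomorphism `ℤ[G/D]/p ≅ V`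
(surjective by the span hypothesis, bijective by the count), so `ψ V = ψ (ℤ[G/D]/p)`
(`Representation.ofMulAction` on `G ⧸ D →₀ ℤ`, the object of `PermutationLatticeReduction`).
(Lane use: `V = H²(Γ, Maps(Δ, J_v))[p] = ⊕_{w ∣ v}` lines permuted by `Δ`, `D = Δ_v` acting
trivially by `forall_apply_eq_self_of_card_le_card_invariants`.)
[cite: MilneADT2006, I §5, proof of Thm. 5.1 (p. 70): `[H²(G_S, E_S)(p)]` and the places of `S`]
[cite: SerreLinearRepresentations1977, §15.2 Thm. 32] -/
theorem additive_eq_permutation_quotient_of_generator [hp : Fact p.Prime] (D : Subgroup G)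
    [Finite (G ⧸ D)] {V : Type} [AddCommGroup V] [Finite V] (ρ : Representation ℤ G V)
    (hV : ∀ v : V, (p : ℤ) • v = 0) (v₁ : V) (hD : ∀ d ∈ D, ρ d v₁ = v₁)
    (hspan : Submodule.span ℤ (Set.range fun g : G => ρ g v₁) = ⊤)
    (hcard : Nat.card V = p ^ Nat.card (G ⧸ D)) :
    ψ ρ = ψ ((Representation.ofMulAction ℤ G (G ⧸ D)).quotient ((p : ℤ) • ⊤)
      (smul_top_le_comap (Representation.ofMulAction ℤ G (G ⧸ D)) (p : ℤ))) := by
  classical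
  obtain ⟨good_sub, good_quot, hψ'⟩ := admissible ψ hψ
  have goodV : Finite V ∧ ∀ v : V, (p : ℤ) • v = 0 := ⟨inferInstance, hV⟩
  -- the orbit map on cosets
  let w : G ⧸ D → V := fun c => Quotient.liftOn' c (fun g => ρ g v₁) fun a b hab => by
    have hmem : a⁻¹ * b ∈ D := QuotientGroup.leftRel_apply.1 hab
    change ρ a v₁ = ρ b v₁
    conv_rhs => rw [show b = a * (a⁻¹ * b) by rw [mul_inv_cancel_left], map_mul,
      Module.End.mul_apply, hD _ hmem]
  have hw : ∀ g : G, w (QuotientGroup.mk g) = ρ g v₁ := fun _ => rfl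
  have hwg : ∀ (g : G) (c : G ⧸ D), w (g • c) = ρ g (w c) := fun g c => by
    obtain ⟨b, rfl⟩ := QuotientGroup.mk_surjective c
    rw [MulAction.Quotient.smul_mk, smul_eq_mul, hw, hw, map_mul, Module.End.mul_apply]
  let Φ₀ : MonoidAlgebra ℤ (G ⧸ D) →ₗ[ℤ] V :=
    Finsupp.linearCombination ℤ w ∘ₗ (MonoidAlgebra.coeffLinearEquiv ℤ).toLinearMap
  have hΦ₀of : ∀ f' : G ⧸ D →₀ ℤ, Φ₀ (MonoidAlgebra.ofCoeff f') = Finsupp.linearCombination ℤ w f' :=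
    fun _ => rfl
  have hΦ₀single : ∀ (c : G ⧸ D) (a : ℤ), Φ₀ (MonoidAlgebra.single c a) = a • w c := fun c a => by
    change Finsupp.linearCombination ℤ w (MonoidAlgebra.single c a).coeff = a • w c
    rw [MonoidAlgebra.coeff_single, Finsupp.linearCombination_single]
  have hΦ₀ : ∀ (g : G) (f : MonoidAlgebra ℤ (G ⧸ D)),
      Φ₀ (Representation.ofMulAction ℤ G (G ⧸ D) g f) = ρ g (Φ₀ f) := by
    intro g f
    induction f using MonoidAlgebra.induction_linear with
    | zero => rw [map_zero, map_zero, map_zero]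
    | add f₁ f₂ h₁ h₂ => simp only [map_add, h₁, h₂]
    | single c a =>
      rw [Representation.ofMulAction_single, hΦ₀single, hΦ₀single, hwg, map_zsmul]
  have hΦ₀surj : Surjective Φ₀ := fun v => by
    have hrange : LinearMap.range (Finsupp.linearCombination ℤ w) = ⊤ := by
      rw [Finsupp.range_linearCombination, eq_top_iff, ← hspan]
      refine Submodule.span_mono ?_
      rintro _ ⟨g, rfl⟩
      exact ⟨QuotientGroup.mk g, hw g⟩
    obtain ⟨f', hf'⟩ := LinearMap.range_eq_top.1 hrange v
    exact ⟨MonoidAlgebra.ofCoeff f', (hΦ₀of f').trans hf'⟩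
  -- it factors through `ℤ[G/D]/p`
  have hker : ((p : ℤ) • ⊤ : Submodule ℤ (MonoidAlgebra ℤ (G ⧸ D))) ≤ LinearMap.ker Φ₀ := by
    intro f hf
    obtain ⟨f', -, rfl⟩ := (mem_smul_pointwise_iff_exists f _ ⊤).1 hf
    rw [LinearMap.mem_ker, map_smul, hV]
  let Φ : MonoidAlgebra ℤ (G ⧸ D) ⧸ ((p : ℤ) • ⊤ : Submodule ℤ (MonoidAlgebra ℤ (G ⧸ D))) →ₗ[ℤ] V :=
    Submodule.liftQ _ Φ₀ hker
  have hΦmk : ∀ f, Φ (Submodule.Quotient.mk f) = Φ₀ f := fun _ => rfl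
  have hΦsurj : Surjective Φ := fun v => by
    obtain ⟨f, hf⟩ := hΦ₀surj v
    exact ⟨Submodule.Quotient.mk f, by rw [hΦmk, hf]⟩
  haveI : Finite (MonoidAlgebra ℤ (G ⧸ D) ⧸ ((p : ℤ) • ⊤ : Submodule ℤ (MonoidAlgebra ℤ (G ⧸ D)))) :=
    Nat.finite_of_card_ne_zero (by
      rw [natCard_monoidAlgebra_quotient_smul_top]; exact pow_ne_zero _ hp.out.ne_zero)
  have hΦbij : Function.Bijective Φ := hΦsurj.bijective_of_nat_card_le
    (by rw [hcard, natCard_monoidAlgebra_quotient_smul_top])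
  let e := LinearEquiv.ofBijective Φ hΦbij
  have he : ∀ s c, e (((Representation.ofMulAction ℤ G (G ⧸ D)).quotient ((p : ℤ) • ⊤)
      (smul_top_le_comap (Representation.ofMulAction ℤ G (G ⧸ D)) (p : ℤ))) s c) = ρ s (e c) :=
    fun s c => by
    obtain ⟨f, rfl⟩ := mkQ_surjective _ c
    change Φ (Submodule.Quotient.mk (Representation.ofMulAction ℤ G (G ⧸ D) s f)) =
      ρ s (Φ (Submodule.Quotient.mk f))
    rw [hΦmk, hΦmk, hΦ₀]
  exact (Admissible.additive_eq_of_linearEquiv ψ _ good_quot hψ' _ ρ goodV e he).symm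

end Permutation

/-! ### §4. Formal prime-to-`p` descent along an inclusion ∕ trace pair (no `ψ`) -/

/-- **Formal descent.**  Let `i : X → Y`, `π : Y → X` be additive maps and `τ` an action of the finite
group `D` on `Y` such that `π ∘ i = #D`, `i ∘ π = Σ_{d ∈ D} τ d` and every `τ d` fixes the image of
`i`.  If `p ∤ #D` then `i` restricts to an isomorphism `X[p] ≅ Y[p] ∩ Y^D` (Bézout
`a·#D + b·p = 1`: `i x = 0 ⇒ #D·x = 0 ⇒ x = 0` on `X[p]`; a `D`-fixed `y ∈ Y[p]` is
`i (a · π y)`).  No cohomology is involved: the lane instantiates it with `X = Hⁿ(Γ, Maps(Δ/D, A))`,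
`Y = Hⁿ(Γ, Maps(Δ, A))`, `i = Hⁿ(incl)`, `π = Hⁿ(trace)` (additivity of `Hⁿ` in the morphism),
which makes prime-to-`p` descent to ANY subgroup `D ≤ Δ` formal.
[cite: MilneADT2006, I §5, proof of Thm. 5.1 (p. 70): `Hʳ(G_S, M) = Hʳ(Gal(K_S/L), M)^G`]
[cite: SerreLinearRepresentations1977, §15.2] -/
theorem exists_torsionBy_linearEquiv_of_trace [hp : Fact p.Prime] {X Y : Type u} [AddCommGroup X]
    [AddCommGroup Y] {D : Type*} [Group D] [Fintype D] (i : X →ₗ[ℤ] Y) (π : Y →ₗ[ℤ] X)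
    (τ : Representation ℤ D Y) (hπi : ∀ x, π (i x) = (Fintype.card D : ℤ) • x)
    (hiπ : ∀ y, i (π y) = ∑ d, τ d y) (hτi : ∀ d x, τ d (i x) = i x)
    (hpD : ¬ p ∣ Fintype.card D) :
    ∃ e : torsionBy ℤ X (p : ℤ) ≃ₗ[ℤ] ↥(torsionBy ℤ Y (p : ℤ) ⊓ τ.invariants),
      ∀ x, ((e x : ↥(torsionBy ℤ Y (p : ℤ) ⊓ τ.invariants)) : Y) = i x := by
  -- Bézout
  have hcop : IsCoprime (Fintype.card D : ℤ) (p : ℤ) :=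
    Nat.isCoprime_iff_coprime.2 (Nat.Coprime.symm ((Nat.Prime.coprime_iff_not_dvd hp.out).2 hpD))
  obtain ⟨a, b, hab⟩ := hcop
  -- the restriction of `i`
  have hmemY : ∀ x : torsionBy ℤ X (p : ℤ), i x ∈ torsionBy ℤ Y (p : ℤ) ⊓ τ.invariants := fun x => by
    refine Submodule.mem_inf.2 ⟨?_, (Representation.mem_invariants τ _).2 fun d => hτi d x⟩
    rw [mem_torsionBy_iff, ← map_smul, (mem_torsionBy_iff (p : ℤ) (x : X)).1 x.2, map_zero]
  let f : torsionBy ℤ X (p : ℤ) →ₗ[ℤ] ↥(torsionBy ℤ Y (p : ℤ) ⊓ τ.invariants) :=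
    LinearMap.codRestrict _ (i ∘ₗ (torsionBy ℤ X (p : ℤ)).subtype) hmemY
  have hf : ∀ x, ((f x : ↥(torsionBy ℤ Y (p : ℤ) ⊓ τ.invariants)) : Y) = i x := fun _ => rfl
  have hfinj : Injective f := by
    intro x₁ x₂ h
    have h' : i (x₁ : X) = i (x₂ : X) := by rw [← hf, ← hf, h]
    apply Subtype.ext
    -- `x = (a #D + b p) x`
    have key : ∀ x : torsionBy ℤ X (p : ℤ), (x : X) = a • π (i x) := fun x => by
      rw [hπi, smul_smul]
      conv_lhs => rw [← one_smul ℤ (x : X), ← hab, add_smul, mul_smul b,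
        (mem_torsionBy_iff (p : ℤ) (x : X)).1 x.2, smul_zero, add_zero]
    rw [key x₁, key x₂, h']
  have hfsurj : Surjective f := fun y => by
    have hy := Submodule.mem_inf.1 y.2
    have hyp : (p : ℤ) • (y : Y) = 0 := (mem_torsionBy_iff (p : ℤ) (y : Y)).1 hy.1
    have hyD : ∀ d, τ d (y : Y) = y := (Representation.mem_invariants τ _).1 hy.2
    refine ⟨⟨a • π (y : Y), ?_⟩, Subtype.ext ?_⟩
    · rw [mem_torsionBy_iff, smul_comm, ← map_smul, hyp, map_zero, smul_zero]
    · rw [hf, map_smul, hiπ, Finset.sum_congr rfl fun d _ => hyD d, Finset.sum_const,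
        Finset.card_univ, ← natCast_zsmul, smul_smul]
      conv_rhs => rw [← one_smul ℤ (y : Y), ← hab, add_smul, mul_smul b, hyp, smul_zero, add_zero]
  exact ⟨LinearEquiv.ofBijective f ⟨hfinj, hfsurj⟩, fun x => rfl⟩

/-- **Formal descent, counted**: under the hypotheses of `exists_torsionBy_linearEquiv_of_trace`,
`#X[p] = #(Y[p] ∩ Y^D)`. [cite: MilneADT2006, I §5, proof of Thm. 5.1 (p. 70)] -/
theorem natCard_torsionBy_eq_of_trace [hp : Fact p.Prime] {X Y : Type u} [AddCommGroup X]
    [AddCommGroup Y] {D : Type*} [Group D] [Fintype D] (i : X →ₗ[ℤ] Y) (π : Y →ₗ[ℤ] X)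
    (τ : Representation ℤ D Y) (hπi : ∀ x, π (i x) = (Fintype.card D : ℤ) • x)
    (hiπ : ∀ y, i (π y) = ∑ d, τ d y) (hτi : ∀ d x, τ d (i x) = i x)
    (hpD : ¬ p ∣ Fintype.card D) :
    Nat.card (torsionBy ℤ X (p : ℤ)) = Nat.card ↥(torsionBy ℤ Y (p : ℤ) ⊓ τ.invariants) := by
  obtain ⟨e, -⟩ := exists_torsionBy_linearEquiv_of_trace i π τ hπi hiπ hτi hpD
  exact Nat.card_congr e.toEquiv

/-! ### §3′–§4′. The same, for NON-canonical `Module ℤ` structures and presentation-agnostic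
### `p`-torsion submodules

The cohomology carriers of the lane (`continuousCohomology n _`, a `ModuleCat` carrier) come with a
`Module ℤ` instance that is not definitionally `AddCommGroup.toIntModule`; the versions below take
the instances as binders, `ψ` with strict-implicit instance binders (the same Π-type as the binder of
`StableLatticeReductionInvariantInt`), torsion hypotheses in the canonical `ℕ`-scalar form
`p • x = 0`, and the `p`-torsion ∕ fixed submodules through membership characterisations. -/

section InstancePolymorphic

variable {G : Type} [Group G]
variable (ψ : ∀ ⦃X : Type⦄ ⦃_ : AddCommGroup X⦄ ⦃_ : Module ℤ X⦄, Representation ℤ G X → A)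
  (hψ : ∀ ⦃X Y Z : Type⦄ [AddCommGroup X] [Module ℤ X] [AddCommGroup Y] [Module ℤ Y]
    [AddCommGroup Z] [Module ℤ Z] (ρX : Representation ℤ G X) (ρY : Representation ℤ G Y)
    (ρZ : Representation ℤ G Z) (f : X →ₗ[ℤ] Y) (g : Y →ₗ[ℤ] Z),
    (∀ s x, f (ρX s x) = ρY s (f x)) → (∀ s y, g (ρY s y) = ρZ s (g y)) →
    Injective f → Surjective g → LinearMap.range f = LinearMap.ker g → Finite Y →
    (∀ y : Y, (p : ℤ) • y = 0) → ψ ρY = ψ ρX + ψ ρZ)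
include hψ

/-- **Recognition of `ℤ[G/D]/p`, instance-polymorphic form** of
`additive_eq_permutation_quotient_of_generator` (arbitrary `Module ℤ V` instance binder, torsion
hypothesis `p • v = 0` in `ℕ`-form).
[cite: MilneADT2006, I §5, proof of Thm. 5.1 (p. 70)] [cite: SerreLinearRepresentations1977, §15.2 Thm. 32] -/
theorem additive_eq_permutation_quotient_of_generator' [hp : Fact p.Prime] (D : Subgroup G)
    [Finite (G ⧸ D)] {V : Type} [AddCommGroup V] [instV : Module ℤ V] [Finite V]
    (ρ : Representation ℤ G V) (hV : ∀ v : V, p • v = 0) (v₁ : V) (hD : ∀ d ∈ D, ρ d v₁ = v₁)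
    (hspan : Submodule.span ℤ (Set.range fun g : G => ρ g v₁) = ⊤)
    (hcard : Nat.card V = p ^ Nat.card (G ⧸ D)) :
    ψ ρ = ψ ((Representation.ofMulAction ℤ G (G ⧸ D)).quotient ((p : ℤ) • ⊤)
      (smul_top_le_comap (Representation.ofMulAction ℤ G (G ⧸ D)) (p : ℤ))) := by
  cases Subsingleton.elim instV (AddCommGroup.toIntModule V)
  have hV' : ∀ v : V, (p : ℤ) • v = 0 := fun v => (Nat.cast_smul_eq_nsmul ℤ p v).trans (hV v)
  exact additive_eq_permutation_quotient_of_generator ψ hψ D ρ hV' v₁ hD hspan hcard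

end InstancePolymorphic

/-- **Formal descent, instance-polymorphic and presentation-agnostic form** of
`exists_torsionBy_linearEquiv_of_trace`: arbitrary `Module ℤ` instance binders on `X` and `Y`, the
`p`-torsion submodule `NX ≤ X` and the submodule `NY ≤ Y` of `D`-fixed `p`-torsion vectors given
by membership characterisations in `ℕ`-scalar form, and `π ∘ i = #D` in `ℕ`-scalar form.
[cite: MilneADT2006, I §5, proof of Thm. 5.1 (p. 70)] [cite: SerreLinearRepresentations1977, §15.2] -/
theorem exists_linearEquiv_of_trace' [hp : Fact p.Prime] {X Y : Type u} [AddCommGroup X]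
    [instX : Module ℤ X] [AddCommGroup Y] [instY : Module ℤ Y] {D : Type*} [Group D] [Fintype D]
    (i : X →ₗ[ℤ] Y) (π : Y →ₗ[ℤ] X) (τ : Representation ℤ D Y)
    (hπi : ∀ x, π (i x) = Fintype.card D • x) (hiπ : ∀ y, i (π y) = ∑ d, τ d y)
    (hτi : ∀ d x, τ d (i x) = i x) (hpD : ¬ p ∣ Fintype.card D)
    (NX : Submodule ℤ X) (hNX : ∀ x, x ∈ NX ↔ p • x = 0)
    (NY : Submodule ℤ Y) (hNY : ∀ y, y ∈ NY ↔ p • y = 0 ∧ ∀ d, τ d y = y) :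
    ∃ e : NX ≃ₗ[ℤ] NY, ∀ x, ((e x : NY) : Y) = i x := by
  cases Subsingleton.elim instX (AddCommGroup.toIntModule X)
  cases Subsingleton.elim instY (AddCommGroup.toIntModule Y)
  obtain rfl : NX = torsionBy ℤ X (p : ℤ) := Submodule.ext fun x => by
    rw [hNX, mem_torsionBy_iff, Nat.cast_smul_eq_nsmul]
  obtain rfl : NY = torsionBy ℤ Y (p : ℤ) ⊓ τ.invariants := Submodule.ext fun y => by
    rw [hNY, Submodule.mem_inf, mem_torsionBy_iff, Nat.cast_smul_eq_nsmul,
      Representation.mem_invariants]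
  have hπi' : ∀ x, π (i x) = (Fintype.card D : ℤ) • x := fun x =>
    (hπi x).trans (Nat.cast_smul_eq_nsmul ℤ _ x).symm
  exact exists_torsionBy_linearEquiv_of_trace i π τ hπi' hiπ hτi hpD

/-- **Formal descent, counted, presentation-agnostic**: `#NX = #NY` under the hypotheses of
`exists_linearEquiv_of_trace'`. [cite: MilneADT2006, I §5, proof of Thm. 5.1 (p. 70)] -/
theorem natCard_eq_of_trace' [hp : Fact p.Prime] {X Y : Type u} [AddCommGroup X]
    [instX : Module ℤ X] [AddCommGroup Y] [instY : Module ℤ Y] {D : Type*} [Group D] [Fintype D]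
    (i : X →ₗ[ℤ] Y) (π : Y →ₗ[ℤ] X) (τ : Representation ℤ D Y)
    (hπi : ∀ x, π (i x) = Fintype.card D • x) (hiπ : ∀ y, i (π y) = ∑ d, τ d y)
    (hτi : ∀ d x, τ d (i x) = i x) (hpD : ¬ p ∣ Fintype.card D)
    (NX : Submodule ℤ X) (hNX : ∀ x, x ∈ NX ↔ p • x = 0)
    (NY : Submodule ℤ Y) (hNY : ∀ y, y ∈ NY ↔ p • y = 0 ∧ ∀ d, τ d y = y) :
    Nat.card NX = Nat.card NY := by
  obtain ⟨e, -⟩ := exists_linearEquiv_of_trace' i π τ hπi hiπ hτi hpD NX hNX NY hNY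
  exact Nat.card_congr e.toEquiv

end StableLatticeReduction.Int

end Literature.RepresentationTheory.FiniteGroups
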